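import Literature.Probability.RandomPlanarGeometry.CritPercSLEDimensionAssembly
import Literature.Probability.RandomPlanarGeometry.SLEOnePointLowerEstimate
import HarnessLib

/-!
# Beffara's dimension theorem: what remains is the two-point estimate

Topic `Probability/RandomPlanarGeometry`; theorems only. With the one-point lower estimate proved
(`exists_onePoint_lower_of_isCompact`, `SLEOnePointLowerEstimate.lean`; V. Beffara, *The dimension
of the SLE curves*, Ann. Probab. 36 (2008), Prop. 4, lower half) the reductions of
`CritPercSLEDimensionAssembly.lean` specialise to:

* `ae_dimH_range_sleTrace_eq_of_lt_eight_of_twoPoint` — for one `0 < κ < 8`, almost surely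
  `dim_H γ[0, ∞) = 1 + κ/8` given only the two-point estimate at this `κ` (Beffara (2008), §3,
  (3.5) with §3.2; Lawler–Werness (2013), Thm. 2);
* `ae_dimH_range_sleTrace_of_hasSLETrace_eight_of_twoPoint` — the named fact
  `ae_dimH_range_sleTrace` (`0 < κ ≤ 8`) from the SLE₈ trace theorem (Lawler–Schramm–Werner (2004),
  Thm. 4.7 — needed only at `κ = 8`, where the fact is equivalent to it,
  `ae_dimH_range_sleTrace_eight_iff_hasSLETrace_eight`) and the two-point estimate alone.

Everything else of Beffara's proof — the upper bound (Rohde–Schramm's Cor. 8.2), the one-point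
estimate (upper half for every exponent `a < 1 - κ/8`, Lemma 6.3 / Thm. 8.1; lower half sharp,
Prop. 4), the 0–1 law (Lemma 3), the second-moment method (Prop. 1), the energies, transience
(Thm. 7.1) and the existence of the trace for `κ ≠ 8` (Thm. 5.1) — is proved in this library.

## References

* V. Beffara, *The dimension of the SLE curves*, Ann. Probab. 36 (2008) 1421–1452: Theorem
  (Introduction), Prop. 1, Lemma 3, Prop. 4, §3 (3.5).
* G. F. Lawler, B. M. Werness, *Multi-point Green's functions for SLE and an estimate of Beffara*,
  Ann. Probab. 41 (2013), Thm. 2.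
* G. F. Lawler, O. Schramm, W. Werner, *Conformal invariance of planar loop-erased random walks and
  uniform spanning trees*, Ann. Probab. 32 (2004), Thm. 4.7.
-/

noncomputable section

open Set Filter Topology MeasureTheory Metric Complex
open UpperHalfPlane (upperHalfPlaneSet isOpen_upperHalfPlaneSet)
open Literature.MeasureTheory.Hausdorff
open scoped NNReal ENNReal

namespace Literature.Probability.RandomPlanarGeometry

open Loewner Literature.Probability.Process

variable {κ : ℝ≥0}

/-! ### With the one-point lower estimate proved: only the two-point estimate remains -/

/-- **For one `0 < κ < 8`: almost surely `dim_H γ[0, ∞) = 1 + κ/8`, given only the two-point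
estimate at this `κ`** (Beffara (2008), §3, (3.5) with §3.2; Lawler–Werness (2013), Thm. 2), in its
printed local form `hC`. The one-point lower estimate is `exists_onePoint_lower_of_isCompact`
(Beffara's Prop. 4, proved in `SLEOnePointLowerEstimate.lean`, the trace existing by Thm. 5.1).
[cite: Beffara2008, Theorem (Introduction), Prop. 1, Lemma 3, Prop. 4 and (3.5)] -/
theorem ae_dimH_range_sleTrace_eq_of_lt_eight_of_twoPoint (hκ0 : 0 < κ) (hκ8 : κ < 8)
    (hC : ∀ K : Set ℂ, IsCompact K → K ⊆ upperHalfPlaneSet →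
      ∃ c₃ : ℝ≥0∞, c₃ ≠ ⊤ ∧ ∃ ε₀ : ℝ, 0 < ε₀ ∧ ∀ ε : ℝ, 0 < ε → ε ≤ ε₀ → ∀ x ∈ K, ∀ y ∈ K,
        preWienerMeasure {ω | infDist x (range (sleTrace κ ω)) ≤ ε ∧
            infDist y (range (sleTrace κ ω)) ≤ ε} ≤
          c₃ * ENNReal.ofReal (ε ^ (1 - (κ : ℝ) / 8)) ^ 2 * rieszKernel (1 - (κ : ℝ) / 8) x y) :
    ∀ᵐ ω ∂preWienerMeasure, dimH (range (sleTrace κ ω)) = 1 + (κ : ℝ≥0∞) / 8 :=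
  ae_dimH_range_sleTrace_eq_of_lt_eight_of_estimates hκ0 hκ8
    (exists_onePoint_lower_of_isCompact hκ0 hκ8 (hasSLETrace_of_ne_eight_apply hκ8.ne)) hC

/-- **`ae_dimH_range_sleTrace` (Beffara's theorem, `0 < κ ≤ 8`) from the SLE₈ trace theorem and
the two-point estimate alone.** Inputs: `h8e` — Lawler–Schramm–Werner (2004), Thm. 4.7 (SLE₈ is
generated by a curve; needed only at `κ = 8`, where the fact is equivalent to it,
`ae_dimH_range_sleTrace_eight_iff_hasSLETrace_eight`); `hC` — Beffara (2008), §3, the two-point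
estimate (3.5) with §3.2 (for `0 < κ < 8`). Everything else of Beffara's proof — the upper bound
(Rohde–Schramm's Cor. 8.2), the one-point estimate (upper half for every exponent `a < 1 - κ/8`, Lemma 6.3 /
Thm. 8.1; lower half sharp, Prop. 4), the 0–1 law
(Lemma 3), the second-moment method (Prop. 1), the energies, transience (Thm. 7.1) and the
existence of the trace for `κ ≠ 8` (Thm. 5.1) — is proved in this library.
[cite: Beffara2008, Theorem (Introduction); LawlerSchrammWerner2004, Thm 4.7] -/
theorem ae_dimH_range_sleTrace_of_hasSLETrace_eight_of_twoPoint (h8e : hasSLETrace_eight)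
    (hC : ∀ {κ : ℝ≥0}, 0 < κ → κ < 8 → ∀ K : Set ℂ, IsCompact K → K ⊆ upperHalfPlaneSet →
      ∃ c₃ : ℝ≥0∞, c₃ ≠ ⊤ ∧ ∃ ε₀ : ℝ, 0 < ε₀ ∧ ∀ ε : ℝ, 0 < ε → ε ≤ ε₀ → ∀ x ∈ K, ∀ y ∈ K,
        preWienerMeasure {ω | infDist x (range (sleTrace κ ω)) ≤ ε ∧
            infDist y (range (sleTrace κ ω)) ≤ ε} ≤
          c₃ * ENNReal.ofReal (ε ^ (1 - (κ : ℝ) / 8)) ^ 2 * rieszKernel (1 - (κ : ℝ) / 8) x y)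
    {κ : ℝ≥0} : ae_dimH_range_sleTrace (κ := κ) := by
  intro hκ0 hκ8
  rcases hκ8.lt_or_eq with hlt | rfl
  · exact ae_dimH_range_sleTrace_eq_of_lt_eight_of_twoPoint hκ0 hlt (hC hκ0 hlt)
  · exact ae_dimH_range_sleTrace_eight_of_hasSLETrace_eight h8e hκ0 hκ8

end Literature.Probability.RandomPlanarGeometry

end
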